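import Summits.BirchSwinnertonDyer.BirchSwinnertonDyer.Theorems.AlignedTransportAtTwoMainConjectureOfRankZeroBSDAtTwoFineRoadCoinvDataTight
import HarnessLib

/-!
# Route `AlignedTransportAtTwo`, crux C2 `MainConjectureOfRankZeroBSDAtTwo` (stmt-BirchSwinnertonDyer-22298):
# the registered data stub K₂″ is NOT MORE than the `μ`-inequality — a junk model, and the per-datum `iff`

HONEST FRAMING (cell `bsd-f1-sign2`, WIDTH-5 attached prover seat `bsd-line-att-p3` gen 2, line `birth` of the
lead `bsd-line-att-p2`; BSD is NOT proved by any of this). THEOREMS ONLY; nothing asserted. Continuation of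
`…FineRoadCoinvDataTight` (FORWARD: the `∃`-data of the registered stub `stub_katoCoinvDataQiAtTwo` give Kato's
`μ`-inequality `ℓ_{(2)}(X) ≤ ℓ_{(2)}(Λ/(G₊)) + ℓ_{(2)}(X₀)`; and the inequality road to T / C2). Here:

* §4 CONVERSE by an explicit JUNK MODEL (`exists_coinvDatum_of_lengthAt_le`, any prime `p`): if `X_D, X_Y` are
  finitely generated torsion, `G ≠ 0` and the inequality holds, the displayed `∃`-data EXIST — `P = Λ²`,
  `col = id`, `c_P = swap`, `X' = X_D × X_Y × Λ/(G)`, `c_{X'} = c_{Y'} = 1`, `toX (x,y) = (0,0,[x+y])`,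
  `Y' = X_D × X_Y`, `fd`/`fy` the projections, `w₁ = (G,0)`, `w₂ = (0,G)`, `s = 1`. So the `∃`-over-Types shape
  CERTIFIES NO PROVENANCE (nothing in it says the modules are Kato's `𝐇¹`, `H¹_{/f}`, `X(E/K_∞)`), and the
  archimedean-balance clause is ABSORBED (the junk model has trivial `Δ`-action).
* §5 the per-datum `iff` at `2` (`katoCoinvDatum_iff_lengthAt_le_two`): for `X(W/ℚ_∞)`, `X₀(W/ℚ_∞)` f.g. torsion
  and `G₊ ≠ 0`, the stub's data for `(D, Yd, G₊)` exist iff `ℓ_{(2)}(X) ≤ ℓ_{(2)}(Λ/(G₊)) + ℓ_{(2)}(X₀)`.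

RECOMMENDATION to the lead / planner (not a route edit): register the INEQUALITY as the road-(b″) stub (it is
implied by K₂″, suffices for T, and is the sentence a typer extracts from Kato §17.13 over `ℚ(ζ_{2^∞})` + the
descent); keep the data shape as the typer's checklist. Conditional content unchanged.

References: K. Kato, Astérisque 295 (2004), §12.1, Thm. 17.4, Prop. 17.11, §17.13; R. Greenberg, LNM 1716 (1999)
§3–§4; J. Coates, R. Sujatha, Math. Ann. 331 (2005) §3; L. Washington, GTM 83, §13.2.
-/

set_option linter.dupNamespace false
set_option autoImplicit false

noncomputable section

open scoped Classical

open Literature.NumberTheory.EllipticCurves Literature.NumberTheory.EllipticCurves.Module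

namespace Summit.BirchSwinnertonDyer.BirchSwinnertonDyer.Theorems.AlignedTransportAtTwoFineRoad

/-! ## §4 Converse: a junk model — the `∃`-shape certifies no provenance -/

section JunkModel

variable (p : ℕ) [Fact p.Prime]

/-- **CONVERSE (junk model): the `μ`-inequality ⟹ the displayed road-(b″) data.** If `X_D` and `X_Y` are
finitely generated torsion `Λ₀`-modules, `G ≠ 0`, and `ℓ_{(p)}(X_D) ≤ ℓ_{(p)}(Λ₀/(G)) + ℓ_{(p)}(X_Y)`, then data
of EXACTLY the shape displayed in the registered stub K₂″ (`KatoCoinvDataQiAtTwo`) exist for the targets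
`(X_D, X_Y, G)`: `P = Λ₀²`, `col = id` (finite cokernel `0`), `c_P = swap`, `X' = X_D × (X_Y × Λ₀/(G))` with
TRIVIAL `Δ`-action `c_{X'} = 1`, `toX (x, y) = (0, 0, [x + y])`, `Y' = X_D × X_Y` with `π` forgetting the last
factor and `c_{Y'} = 1`, `w₁ = (G, 0)`, `w₂ = (0, G)`, `a = G`, `b = 0`, `s = 1`, `fd` = first projection
(kernel `X_Y × Λ₀/(G)`), `fy` = second projection (kernel `X_D`); the balance `ℓ(ker fy) ≤ ℓ(ker fd)` is then
the assumed inequality. Moral: as an `∃` over abstract modules the stub says NOTHING about the modules being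
Kato's `𝐇¹`, `H¹_{/f}`, `X(E/K_∞)`, `X₀(E/K_∞)_Δ`; its content is the inequality of §2–§3 and no more, and the
archimedean-balance clause is absorbed. [folklore] -/
theorem exists_coinvDatum_of_lengthAt_le {XD XY : Type} [AddCommGroup XD] [_root_.Module (IwasawaAlgebra p) XD]
    [AddCommGroup XY] [_root_.Module (IwasawaAlgebra p) XY]
    [Module.Finite (IwasawaAlgebra p) XD] [Module.Finite (IwasawaAlgebra p) XY]
    (hXDt : Module.IsTorsion (IwasawaAlgebra p) XD) (hXYt : Module.IsTorsion (IwasawaAlgebra p) XY)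
    (𝔭 : PrimeSpectrum (IwasawaAlgebra p)) (h𝔭 : 𝔭.asIdeal = IwasawaAlgebra.augIdealP p)
    {G : IwasawaAlgebra p} (hG : G ≠ 0)
    (hle : lengthAt (IwasawaAlgebra p) XD 𝔭 ≤
      lengthAt (IwasawaAlgebra p) (IwasawaAlgebra p ⧸ Ideal.span {G}) 𝔭 + lengthAt (IwasawaAlgebra p) XY 𝔭) :
    ∃ (P X' Y' : Type) (_ : AddCommGroup P) (_ : _root_.Module (IwasawaAlgebra p) P)
      (_ : AddCommGroup X') (_ : _root_.Module (IwasawaAlgebra p) X')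
      (_ : AddCommGroup Y') (_ : _root_.Module (IwasawaAlgebra p) Y')
      (toX : P →ₗ[IwasawaAlgebra p] X') (π : X' →ₗ[IwasawaAlgebra p] Y')
      (cP : P →ₗ[IwasawaAlgebra p] P) (cX : X' →ₗ[IwasawaAlgebra p] X')
      (cY : Y' →ₗ[IwasawaAlgebra p] Y')
      (col : P →ₗ[IwasawaAlgebra p] IwasawaAlgebra p × IwasawaAlgebra p) (w₁ w₂ : P)
      (a b s : IwasawaAlgebra p) (fd : (X' ⧸ LinearMap.range (cX - 1)) →ₗ[IwasawaAlgebra p] XD)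
      (fy : (Y' ⧸ LinearMap.range (cY - 1)) →ₗ[IwasawaAlgebra p] XY),
      Function.Exact toX π ∧ Function.Surjective π ∧ toX ∘ₗ cP = cX ∘ₗ toX ∧ π ∘ₗ cX = cY ∘ₗ π ∧
      Function.Injective col ∧
      col ∘ₗ cP = (LinearEquiv.prodComm (IwasawaAlgebra p) (IwasawaAlgebra p) (IwasawaAlgebra p) :
        IwasawaAlgebra p × IwasawaAlgebra p →ₗ[IwasawaAlgebra p] IwasawaAlgebra p × IwasawaAlgebra p) ∘ₗ col ∧
      Finite ((IwasawaAlgebra p × IwasawaAlgebra p) ⧸ LinearMap.range col) ∧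
      toX w₁ = 0 ∧ toX w₂ = 0 ∧ col w₁ = (a, b) ∧ col w₂ = (b, a) ∧
      s ∉ IwasawaAlgebra.augIdealP p ∧ a + b = s * G ∧
      Module.Finite (IwasawaAlgebra p) X' ∧ Module.IsTorsion (IwasawaAlgebra p) X' ∧
      Finite (XD ⧸ LinearMap.range fd) ∧
      lengthAt (IwasawaAlgebra p) (LinearMap.ker fy) 𝔭 ≤ lengthAt (IwasawaAlgebra p) (LinearMap.ker fd) 𝔭 := by
  -- the modules
  let Q : Type := IwasawaAlgebra p ⧸ Ideal.span {G}
  let X' : Type := XD × (XY × Q)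
  let Y' : Type := XD × XY
  -- the maps
  let mkG : IwasawaAlgebra p →ₗ[IwasawaAlgebra p] Q := Submodule.mkQ (Ideal.span {G})
  let sumMap : (IwasawaAlgebra p × IwasawaAlgebra p) →ₗ[IwasawaAlgebra p] IwasawaAlgebra p :=
    LinearMap.fst (IwasawaAlgebra p) (IwasawaAlgebra p) (IwasawaAlgebra p) +
      LinearMap.snd (IwasawaAlgebra p) (IwasawaAlgebra p) (IwasawaAlgebra p)
  let toX : (IwasawaAlgebra p × IwasawaAlgebra p) →ₗ[IwasawaAlgebra p] X' :=
    LinearMap.inr (IwasawaAlgebra p) XD (XY × Q) ∘ₗ LinearMap.inr (IwasawaAlgebra p) XY Q ∘ₗ mkG ∘ₗ sumMap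
  let π : X' →ₗ[IwasawaAlgebra p] Y' :=
    LinearMap.prodMap LinearMap.id (LinearMap.fst (IwasawaAlgebra p) XY Q)
  let cP : (IwasawaAlgebra p × IwasawaAlgebra p) →ₗ[IwasawaAlgebra p] (IwasawaAlgebra p × IwasawaAlgebra p) :=
    (LinearEquiv.prodComm (IwasawaAlgebra p) (IwasawaAlgebra p) (IwasawaAlgebra p) :
      IwasawaAlgebra p × IwasawaAlgebra p →ₗ[IwasawaAlgebra p] IwasawaAlgebra p × IwasawaAlgebra p)
  let NX : Submodule (IwasawaAlgebra p) X' := LinearMap.range ((1 : X' →ₗ[IwasawaAlgebra p] X') - 1)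
  let NY : Submodule (IwasawaAlgebra p) Y' := LinearMap.range ((1 : Y' →ₗ[IwasawaAlgebra p] Y') - 1)
  have hNX : NX = ⊥ := by simp only [NX, sub_self, LinearMap.range_zero]
  have hNY : NY = ⊥ := by simp only [NY, sub_self, LinearMap.range_zero]
  let fd : (X' ⧸ NX) →ₗ[IwasawaAlgebra p] XD :=
    NX.liftQ (LinearMap.fst (IwasawaAlgebra p) XD (XY × Q)) (by rw [hNX]; exact bot_le)
  let fy : (Y' ⧸ NY) →ₗ[IwasawaAlgebra p] XY :=
    NY.liftQ (LinearMap.snd (IwasawaAlgebra p) XD XY) (by rw [hNY]; exact bot_le)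
  -- elementary identities
  have htoX : ∀ x y : IwasawaAlgebra p, toX (x, y) = (0, (0, mkG (x + y))) := fun x y => rfl
  have hπ_apply : ∀ (d : XD) (y : XY) (q : Q), π (d, (y, q)) = (d, y) := fun d y q => rfl
  have hmkG : mkG G = 0 := (Submodule.Quotient.mk_eq_zero _).mpr (Ideal.mem_span_singleton_self G)
  -- exactness of the row
  have hexact : Function.Exact toX π := by
    rintro ⟨d, y, q⟩
    constructor
    · intro h
      rw [hπ_apply, Prod.mk_eq_zero] at h
      obtain ⟨rfl, rfl⟩ := h
      obtain ⟨r, hr⟩ := Submodule.mkQ_surjective (Ideal.span {G}) q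
      exact ⟨(r, 0), by rw [htoX, add_zero]; exact congrArg (fun t => ((0 : XD), ((0 : XY), t))) hr⟩
    · rintro ⟨⟨x, y'⟩, hxy⟩
      rw [← hxy, htoX, hπ_apply, Prod.mk_eq_zero]
      exact ⟨rfl, rfl⟩
  have hπsurj : Function.Surjective π := fun ⟨d, y⟩ => ⟨(d, (y, 0)), rfl⟩
  have hfd_surj : Function.Surjective fd := fun d =>
    ⟨Submodule.Quotient.mk (d, (0, 0)), by rw [Submodule.liftQ_apply]; rfl⟩
  have hfy_surj : Function.Surjective fy := fun y =>
    ⟨Submodule.Quotient.mk (0, y), by rw [Submodule.liftQ_apply]; rfl⟩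
  -- finiteness / torsion of `X'` (a product of torsion modules is torsion; `Λ/(G)` is torsion for `G ≠ 0`)
  have hprod : ∀ {A B : Type} [AddCommGroup A] [_root_.Module (IwasawaAlgebra p) A] [AddCommGroup B]
      [_root_.Module (IwasawaAlgebra p) B], Module.IsTorsion (IwasawaAlgebra p) A →
      Module.IsTorsion (IwasawaAlgebra p) B → Module.IsTorsion (IwasawaAlgebra p) (A × B) := by
    intro A B _ _ _ _ hA hB x
    obtain ⟨u, hu⟩ := @hA x.1
    obtain ⟨v, hv⟩ := @hB x.2
    refine ⟨u * v, ?_⟩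
    rw [Submonoid.smul_def] at hu hv ⊢
    refine Prod.ext ?_ ?_
    · rw [Prod.smul_fst, Submonoid.coe_mul, mul_comm, mul_smul, hu, smul_zero, Prod.fst_zero]
    · rw [Prod.smul_snd, Submonoid.coe_mul, mul_smul, hv, smul_zero, Prod.snd_zero]
  have hQt : Module.IsTorsion (IwasawaAlgebra p) Q := by
    intro x
    refine ⟨⟨G, mem_nonZeroDivisors_of_ne_zero hG⟩, ?_⟩
    obtain ⟨r, rfl⟩ := Submodule.Quotient.mk_surjective _ x
    rw [Submonoid.smul_def, ← Submodule.Quotient.mk_smul, Submodule.Quotient.mk_eq_zero, smul_eq_mul]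
    exact Ideal.mul_mem_right _ _ (Ideal.mem_span_singleton_self G)
  have hX't : Module.IsTorsion (IwasawaAlgebra p) X' := hprod hXDt (hprod hXYt hQt)
  haveI hX'fg : Module.Finite (IwasawaAlgebra p) X' := inferInstance
  -- lengths
  have hXD_ne : lengthAt (IwasawaAlgebra p) XD 𝔭 ≠ ⊤ := lengthAt_ne_top_of_isTorsion p XD hXDt 𝔭 h𝔭
  have hXY_ne : lengthAt (IwasawaAlgebra p) XY 𝔭 ≠ ⊤ := lengthAt_ne_top_of_isTorsion p XY hXYt 𝔭 h𝔭
  have hX'len : lengthAt (IwasawaAlgebra p) (X' ⧸ NX) 𝔭 =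
      lengthAt (IwasawaAlgebra p) XD 𝔭 + (lengthAt (IwasawaAlgebra p) XY 𝔭 + lengthAt (IwasawaAlgebra p) Q 𝔭) := by
    rw [lengthAt_eq_of_linearEquiv (Submodule.quotEquivOfEqBot NX hNX) 𝔭, lengthAt_prod, lengthAt_prod]
  have hY'len : lengthAt (IwasawaAlgebra p) (Y' ⧸ NY) 𝔭 =
      lengthAt (IwasawaAlgebra p) XD 𝔭 + lengthAt (IwasawaAlgebra p) XY 𝔭 := by
    rw [lengthAt_eq_of_linearEquiv (Submodule.quotEquivOfEqBot NY hNY) 𝔭, lengthAt_prod]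
  have hfd_len : lengthAt (IwasawaAlgebra p) (X' ⧸ NX) 𝔭 =
      lengthAt (IwasawaAlgebra p) (LinearMap.ker fd) 𝔭 + lengthAt (IwasawaAlgebra p) XD 𝔭 :=
    lengthAt_eq_add_of_exact (LinearMap.ker fd).subtype fd (Submodule.injective_subtype _) hfd_surj
      (LinearMap.exact_subtype_ker_map fd) 𝔭
  have hfy_len : lengthAt (IwasawaAlgebra p) (Y' ⧸ NY) 𝔭 =
      lengthAt (IwasawaAlgebra p) (LinearMap.ker fy) 𝔭 + lengthAt (IwasawaAlgebra p) XY 𝔭 :=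
    lengthAt_eq_add_of_exact (LinearMap.ker fy).subtype fy (Submodule.injective_subtype _) hfy_surj
      (LinearMap.exact_subtype_ker_map fy) 𝔭
  have hker_fd : lengthAt (IwasawaAlgebra p) XY 𝔭 + lengthAt (IwasawaAlgebra p) Q 𝔭 ≤
      lengthAt (IwasawaAlgebra p) (LinearMap.ker fd) 𝔭 := by
    refine (ENat.add_le_add_iff_left hXD_ne).mp ?_
    rw [← hX'len, hfd_len, add_comm]
  have hker_fy : lengthAt (IwasawaAlgebra p) (LinearMap.ker fy) 𝔭 ≤ lengthAt (IwasawaAlgebra p) XD 𝔭 := by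
    refine (ENat.add_le_add_iff_left hXY_ne).mp ?_
    rw [add_comm (lengthAt (IwasawaAlgebra p) XY 𝔭), add_comm (lengthAt (IwasawaAlgebra p) XY 𝔭), ← hfy_len,
      hY'len]
  refine ⟨IwasawaAlgebra p × IwasawaAlgebra p, X', Y', inferInstance, inferInstance, inferInstance, inferInstance,
    inferInstance, inferInstance, toX, π, cP, 1, 1, LinearMap.id, (G, 0), (0, G), G, 0, 1, fd, fy, hexact, hπsurj,
    ?_, ?_, fun _ _ h => h, ?_, ?_, ?_, ?_, rfl, rfl, one_not_mem_augIdealP, by rw [add_zero, one_mul], hX'fg, hX't,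
    ?_, ?_⟩
  · -- `toX ∘ swap = toX` (the sum is symmetric)
    apply LinearMap.ext
    rintro ⟨x, y⟩
    change toX (y, x) = toX (x, y)
    rw [htoX, htoX, add_comm]
  · rw [Module.End.one_eq_id, Module.End.one_eq_id, LinearMap.comp_id, LinearMap.id_comp]
  · rw [LinearMap.id_comp, LinearMap.comp_id]
  · haveI : Subsingleton ((IwasawaAlgebra p × IwasawaAlgebra p) ⧸
        LinearMap.range (LinearMap.id : IwasawaAlgebra p × IwasawaAlgebra p →ₗ[IwasawaAlgebra p] _)) :=
      Submodule.Quotient.subsingleton_iff.mpr LinearMap.range_id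
    infer_instance
  · rw [htoX, add_zero, hmkG]; rfl
  · rw [htoX, zero_add, hmkG]; rfl
  · haveI : Subsingleton (XD ⧸ LinearMap.range fd) :=
      Submodule.Quotient.subsingleton_iff.mpr (LinearMap.range_eq_top.mpr hfd_surj)
    infer_instance
  · calc lengthAt (IwasawaAlgebra p) (LinearMap.ker fy) 𝔭
        ≤ lengthAt (IwasawaAlgebra p) XD 𝔭 := hker_fy
      _ ≤ lengthAt (IwasawaAlgebra p) Q 𝔭 + lengthAt (IwasawaAlgebra p) XY 𝔭 := hle
      _ = lengthAt (IwasawaAlgebra p) XY 𝔭 + lengthAt (IwasawaAlgebra p) Q 𝔭 := add_comm _ _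
      _ ≤ lengthAt (IwasawaAlgebra p) (LinearMap.ker fd) 𝔭 := hker_fd

end JunkModel

/-! ## §5 Per datum at `2`: the registered `∃`-data ⟺ the `μ`-inequality -/

section PerDatum

open WeierstrassCurve Summit.BirchSwinnertonDyer.Rank1Residual.X1.MuLambda

/-- **PER-DATUM EQUIVALENCE at `2`.** For a curve `W/ℚ`, dual data `D` (of `Sel_{2^∞}(W/ℚ_∞)`) and `Yd` (of the
fine part) with finitely generated torsion modules, and `G₊ ≠ 0`: the `∃`-data displayed in the registered
stub K₂″ (`KatoCoinvDataQiAtTwo`, instance `(D, Yd, G₊)`) EXIST iff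
`ℓ_{(2)}(D.X) ≤ ℓ_{(2)}(Λ/(G₊)) + ℓ_{(2)}(Yd.X)`. (→ §2; ← the junk model of §4.) On the seed cell the side
conditions hold modulo PRINT (Kato 17.4 (1) at `2`: `X` f.g. torsion; statement (A): `X₀` f.g. torsion;
`red G₊ ≠ 0`). [cite: Kato2004Asterisque, Thm. 17.4 (1) (p. 273) and §17.13 (pp. 279–280)]
[cite: CoatesSujatha2005, statement (A) (§3)] -/
theorem katoCoinvDatum_iff_lengthAt_le_two (W : WeierstrassCurve ℚ) {κ : ZpExtension ℚ 2}
    {γ : Field.absoluteGaloisGroup ℚ} (D : W.SelmerDualData κ γ) (Yd : W.FineSelmerDualData κ γ)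
    [Module.Finite (IwasawaAlgebra 2) D.X] (hDt : D.IsTorsion) [Module.Finite (IwasawaAlgebra 2) Yd.X]
    (hYt : Module.IsTorsion (IwasawaAlgebra 2) Yd.X) {Gp : IwasawaAlgebra 2} (hGp : Gp ≠ 0) :
    (∃ (P X' Y' : Type) (_ : AddCommGroup P) (_ : _root_.Module (IwasawaAlgebra 2) P)
          (_ : AddCommGroup X') (_ : _root_.Module (IwasawaAlgebra 2) X')
          (_ : AddCommGroup Y') (_ : _root_.Module (IwasawaAlgebra 2) Y')
          (toX : P →ₗ[IwasawaAlgebra 2] X') (π : X' →ₗ[IwasawaAlgebra 2] Y')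
          (cP : P →ₗ[IwasawaAlgebra 2] P) (cX : X' →ₗ[IwasawaAlgebra 2] X')
          (cY : Y' →ₗ[IwasawaAlgebra 2] Y')
          (col : P →ₗ[IwasawaAlgebra 2] IwasawaAlgebra 2 × IwasawaAlgebra 2) (w₁ w₂ : P)
          (a b s : IwasawaAlgebra 2) (fd : (X' ⧸ LinearMap.range (cX - 1)) →ₗ[IwasawaAlgebra 2] D.X)
          (fy : (Y' ⧸ LinearMap.range (cY - 1)) →ₗ[IwasawaAlgebra 2] Yd.X),
          Function.Exact toX π ∧ Function.Surjective π ∧ toX ∘ₗ cP = cX ∘ₗ toX ∧ π ∘ₗ cX = cY ∘ₗ π ∧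
          Function.Injective col ∧
          col ∘ₗ cP = (LinearEquiv.prodComm (IwasawaAlgebra 2) (IwasawaAlgebra 2) (IwasawaAlgebra 2) :
            IwasawaAlgebra 2 × IwasawaAlgebra 2 →ₗ[IwasawaAlgebra 2]
              IwasawaAlgebra 2 × IwasawaAlgebra 2) ∘ₗ col ∧
          Finite ((IwasawaAlgebra 2 × IwasawaAlgebra 2) ⧸ LinearMap.range col) ∧
          toX w₁ = 0 ∧ toX w₂ = 0 ∧ col w₁ = (a, b) ∧ col w₂ = (b, a) ∧
          s ∉ IwasawaAlgebra.augIdealP 2 ∧ a + b = s * Gp ∧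
          Module.Finite (IwasawaAlgebra 2) X' ∧ Module.IsTorsion (IwasawaAlgebra 2) X' ∧
          Finite (D.X ⧸ LinearMap.range fd) ∧
          lengthAt (IwasawaAlgebra 2) (LinearMap.ker fy)
              ⟨IwasawaAlgebra.augIdealP 2, IwasawaAlgebra.isPrime_augIdealP_holds 2⟩ ≤
            lengthAt (IwasawaAlgebra 2) (LinearMap.ker fd)
              ⟨IwasawaAlgebra.augIdealP 2, IwasawaAlgebra.isPrime_augIdealP_holds 2⟩) ↔
      lengthAt (IwasawaAlgebra 2) D.X ⟨IwasawaAlgebra.augIdealP 2, IwasawaAlgebra.isPrime_augIdealP_holds 2⟩ ≤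
        lengthAt (IwasawaAlgebra 2) (IwasawaAlgebra 2 ⧸ Ideal.span {Gp})
            ⟨IwasawaAlgebra.augIdealP 2, IwasawaAlgebra.isPrime_augIdealP_holds 2⟩ +
          lengthAt (IwasawaAlgebra 2) Yd.X ⟨IwasawaAlgebra.augIdealP 2, IwasawaAlgebra.isPrime_augIdealP_holds 2⟩ := by
  constructor
  · rintro ⟨P, X', Y', _, _, _, _, _, _, toX, π, cP, cX, cY, col, w₁, w₂, a, b, s, fd, fy, hX, hπ, hcX, hcY, hcol,
      hccol, hfin, h₁, h₂, hw₁, hw₂, hs, hab, hXfg, hXt, hfd, harch⟩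
    have h := lengthAt_le_of_coinvDatum 2 ⟨IwasawaAlgebra.augIdealP 2, IwasawaAlgebra.isPrime_augIdealP_holds 2⟩
      rfl toX π hX hπ cP cX cY hcX hcY col hcol hccol hfin h₁ h₂ hw₁ hw₂ hXfg hXt fd hfd fy harch
    rwa [hab, lengthAt_quotient_span_mul_of_not_mem hs Gp _ rfl] at h
  · intro hle
    exact exists_coinvDatum_of_lengthAt_le 2 hDt hYt _ rfl hGp hle

end PerDatum

end Summit.BirchSwinnertonDyer.BirchSwinnertonDyer.Theorems.AlignedTransportAtTwoFineRoad

end
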